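import Summits.Ventures.HodgeRepro2.T5SU11ResolventNeumann
import Summits.Ventures.HodgeRepro2.T5SU11ResolventMonotoneDecay

/-!
# Two-sided bounds of the resolvent by the partial sums of its Neumann expansion

For a source `g ≥ 0` of the exponentially decaying class, the terms `(μ − μ₂)^k (G^I_{λ₂})^{k+1} g(t)` of the Neumann
expansion of row 503 and its remainder `(μ − μ₂)^{n+1} G^I_λ (G^I_{λ₂})^{n+1} g(t)` have definite signs (row 504:
the iterates alternate in sign and `G^I_λ` reverses order), so the partial sums `S_n` bound the resolvent:

* **`neumann_le_partial_sum`** — for `λ ≤ λ₂` every term and the remainder are `≤ 0`: `G^I_λ g(t) ≤ S_n` for every `n`,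
  and the partial sums decrease (`partial_sum_antitone`);
* **`partial_sum_le_of_even`, `le_partial_sum_of_odd`** — for `λ₂ ≤ λ` the remainder has the sign `(−1)^n`:
  `S_n ≤ G^I_λ g(t)` for even `n` and `G^I_λ g(t) ≤ S_n` for odd `n` — the alternating-series bounds;
* **`two_sided_bound`** — in particular, for `1 < λ₂ ≤ λ`,
  `G^I_{λ₂} g(t) ≤ G^I_λ g(t) ≤ G^I_{λ₂} g(t) + (μ − μ₂) · G^I_{λ₂}(G^I_{λ₂} g)(t)`:
  the resolvent at `λ` is squeezed between the first two partial sums of its expansion at `λ₂`.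

Nothing is claimed about (N).

Blind lane: Mathlib + the HodgeRepro2 prefix only; no sorry; axioms ⊆ {propext, Classical.choice,
Quot.sound}.
-/

namespace Summit.Ventures.HodgeRepro2.T5SU11ResolventNeumannBounds

open Filter Topology MeasureTheory
open Set (Ioi Ioc)
open T5SU11Cartan T5SU11SphericalFunction T5SU11SphericalDecay T5SU11RadialGreenImproper
  T5SU11ResolventNeumann T5SU11ResolventMonotoneDecay

section measure

variable [MeasurableSpace Circle] [BorelSpace Circle]

variable {lam lam₂ : ℝ} (hlam : 1 < lam) (hlam₂ : 1 < lam₂) {g : ℝ → ℝ} (hg : ContinuousOn g (Ioi 0))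
  {M : ℝ} (hM : ∀ s ∈ Ioc (0 : ℝ) 1, |g s| ≤ M) (hM0 : 0 ≤ M)
  {ε C s₀ : ℝ} (hε : 2 - lam < ε) (hε₂ : 2 - lam₂ < ε) (hC : ∀ s, s₀ ≤ s → |g s| ≤ C * Real.exp (-ε * s))
  (hg0 : ∀ s, 0 < s → 0 ≤ g s)

include hlam hlam₂ hg0 in
/-- `G^I_λ (G^I_{λ₂})^{n+1} g` has the sign `(−1)^n` on `(0, ∞)` for a source `g ≥ 0`. -/
theorem greenSolI_iterate_sign (n : ℕ) {t : ℝ} (ht : 0 < t) :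
    0 ≤ (-1 : ℝ) ^ n * greenSolI (fun t => sph lam (hyp t)) (sphDecay lam)
      ((greenSolI (fun t => sph lam₂ (hyp t)) (sphDecay lam₂))^[n + 1] g) t := by
  rcases Nat.even_or_odd n with hn | hn
  · -- `h_{n+1} ≤ 0`, so `G^I_λ h_{n+1} ≥ 0`
    rw [hn.neg_one_pow, one_mul]
    apply greenSolI_nonneg hlam _ ht
    intro s hs
    have h := iterate_sign hlam₂ hg0 (n + 1) hs
    rw [pow_succ, hn.neg_one_pow, one_mul] at h
    linarith
  · rw [hn.neg_one_pow]
    have : greenSolI (fun t => sph lam (hyp t)) (sphDecay lam)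
        ((greenSolI (fun t => sph lam₂ (hyp t)) (sphDecay lam₂))^[n + 1] g) t ≤ 0 := by
      apply greenSolI_nonpos hlam _ ht
      intro s hs
      have h := iterate_sign hlam₂ hg0 (n + 1) hs
      rw [pow_succ, hn.neg_one_pow] at h
      linarith
    linarith

omit [MeasurableSpace Circle] [BorelSpace Circle] in
/-- `(μ − μ₂)^k = (−1)^k (μ₂ − μ)^k`. -/
theorem mu_sub_pow (lam lam₂ : ℝ) (k : ℕ) :
    (lam * (lam - 2) - lam₂ * (lam₂ - 2)) ^ k = (-1 : ℝ) ^ k * (lam₂ * (lam₂ - 2) - lam * (lam - 2)) ^ k := by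
  rw [← mul_pow]
  congr 1
  ring

include hlam hlam₂ hg0 in
/-- For `λ ≤ λ₂` every term of the Neumann expansion is `≤ 0`. -/
theorem neumann_term_nonpos (hle : lam ≤ lam₂) (k : ℕ) {t : ℝ} (ht : 0 < t) :
    (lam * (lam - 2) - lam₂ * (lam₂ - 2)) ^ k
      * (greenSolI (fun t => sph lam₂ (hyp t)) (sphDecay lam₂))^[k + 1] g t ≤ 0 := by
  have hκ : 0 ≤ lam₂ * (lam₂ - 2) - lam * (lam - 2) := by nlinarith
  have h := iterate_sign hlam₂ hg0 (k + 1) ht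
  rw [mu_sub_pow]
  have e : (-1 : ℝ) ^ k = -(-1 : ℝ) ^ (k + 1) := by rw [pow_succ]; ring
  rw [e]
  have := mul_nonneg (pow_nonneg hκ k) h
  nlinarith

include hlam hlam₂ hg0 in
/-- For `λ ≤ λ₂` the remainder of the Neumann expansion is `≤ 0`. -/
theorem neumann_remainder_nonpos (hle : lam ≤ lam₂) (n : ℕ) {t : ℝ} (ht : 0 < t) :
    (lam * (lam - 2) - lam₂ * (lam₂ - 2)) ^ (n + 1) * greenSolI (fun t => sph lam (hyp t)) (sphDecay lam)
      ((greenSolI (fun t => sph lam₂ (hyp t)) (sphDecay lam₂))^[n + 1] g) t ≤ 0 := by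
  have hκ : 0 ≤ lam₂ * (lam₂ - 2) - lam * (lam - 2) := by nlinarith
  have h := greenSolI_iterate_sign hlam hlam₂ hg0 n ht
  rw [mu_sub_pow]
  have e : (-1 : ℝ) ^ (n + 1) = -(-1 : ℝ) ^ n := by rw [pow_succ]; ring
  rw [e]
  have := mul_nonneg (pow_nonneg hκ (n + 1)) h
  nlinarith

include hlam hlam₂ hg hM hM0 hε hε₂ hC hg0 in
/-- **For `λ ≤ λ₂` the partial sums bound the resolvent from above**: `G^I_λ g(t) ≤ S_n` for every `n`. -/
theorem neumann_le_partial_sum (hle : lam ≤ lam₂) (n : ℕ) {t : ℝ} (ht : 0 < t) :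
    greenSolI (fun t => sph lam (hyp t)) (sphDecay lam) g t
      ≤ ∑ k ∈ Finset.range (n + 1), (lam * (lam - 2) - lam₂ * (lam₂ - 2)) ^ k
          * (greenSolI (fun t => sph lam₂ (hyp t)) (sphDecay lam₂))^[k + 1] g t := by
  have h := neumann_finite hlam hlam₂ hg hM hM0 hε hε₂ hC n ht
  have hR := neumann_remainder_nonpos hlam hlam₂ hg0 hle n ht
  linarith

include hlam hlam₂ hg0 in
/-- For `λ ≤ λ₂` the partial sums decrease. -/
theorem partial_sum_antitone (hle : lam ≤ lam₂) {t : ℝ} (ht : 0 < t) :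
    Antitone (fun n : ℕ => ∑ k ∈ Finset.range (n + 1), (lam * (lam - 2) - lam₂ * (lam₂ - 2)) ^ k
      * (greenSolI (fun t => sph lam₂ (hyp t)) (sphDecay lam₂))^[k + 1] g t) := by
  apply antitone_nat_of_succ_le
  intro n
  rw [Finset.sum_range_succ _ (n + 1)]
  have := neumann_term_nonpos hlam hlam₂ hg0 hle (n + 1) ht
  linarith

include hlam hlam₂ hg hM hM0 hε hε₂ hC hg0 in
/-- **For `λ₂ ≤ λ` and even `n`, `S_n ≤ G^I_λ g(t)`** (the remainder is `≥ 0`). -/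
theorem partial_sum_le_of_even (hle : lam₂ ≤ lam) {n : ℕ} (hn : Even n) {t : ℝ} (ht : 0 < t) :
    ∑ k ∈ Finset.range (n + 1), (lam * (lam - 2) - lam₂ * (lam₂ - 2)) ^ k
        * (greenSolI (fun t => sph lam₂ (hyp t)) (sphDecay lam₂))^[k + 1] g t
      ≤ greenSolI (fun t => sph lam (hyp t)) (sphDecay lam) g t := by
  have h := neumann_finite hlam hlam₂ hg hM hM0 hε hε₂ hC n ht
  have hκ : 0 ≤ lam * (lam - 2) - lam₂ * (lam₂ - 2) := by nlinarith
  have hs := greenSolI_iterate_sign hlam hlam₂ hg0 n ht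
  rw [hn.neg_one_pow, one_mul] at hs
  have := mul_nonneg (pow_nonneg hκ (n + 1)) hs
  linarith

include hlam hlam₂ hg hM hM0 hε hε₂ hC hg0 in
/-- **For `λ₂ ≤ λ` and odd `n`, `G^I_λ g(t) ≤ S_n`** (the remainder is `≤ 0`). -/
theorem le_partial_sum_of_odd (hle : lam₂ ≤ lam) {n : ℕ} (hn : Odd n) {t : ℝ} (ht : 0 < t) :
    greenSolI (fun t => sph lam (hyp t)) (sphDecay lam) g t
      ≤ ∑ k ∈ Finset.range (n + 1), (lam * (lam - 2) - lam₂ * (lam₂ - 2)) ^ k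
          * (greenSolI (fun t => sph lam₂ (hyp t)) (sphDecay lam₂))^[k + 1] g t := by
  have h := neumann_finite hlam hlam₂ hg hM hM0 hε hε₂ hC n ht
  have hκ : 0 ≤ lam * (lam - 2) - lam₂ * (lam₂ - 2) := by nlinarith
  have hs := greenSolI_iterate_sign hlam hlam₂ hg0 n ht
  rw [hn.neg_one_pow] at hs
  have := mul_nonneg (pow_nonneg hκ (n + 1)) (by linarith : 0 ≤ -greenSolI (fun t => sph lam (hyp t)) (sphDecay lam)
    ((greenSolI (fun t => sph lam₂ (hyp t)) (sphDecay lam₂))^[n + 1] g) t)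
  nlinarith

include hlam hlam₂ hg hM hM0 hε hε₂ hC hg0 in
/-- **THE TWO-SIDED BOUND**: for `1 < λ₂ ≤ λ` and a source `g ≥ 0` of the class,
`G^I_{λ₂} g(t) ≤ G^I_λ g(t) ≤ G^I_{λ₂} g(t) + (μ − μ₂) · G^I_{λ₂}(G^I_{λ₂} g)(t)`. -/
theorem two_sided_bound (hle : lam₂ ≤ lam) {t : ℝ} (ht : 0 < t) :
    greenSolI (fun t => sph lam₂ (hyp t)) (sphDecay lam₂) g t ≤ greenSolI (fun t => sph lam (hyp t)) (sphDecay lam) g t ∧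
    greenSolI (fun t => sph lam (hyp t)) (sphDecay lam) g t
      ≤ greenSolI (fun t => sph lam₂ (hyp t)) (sphDecay lam₂) g t
        + (lam * (lam - 2) - lam₂ * (lam₂ - 2))
          * greenSolI (fun t => sph lam₂ (hyp t)) (sphDecay lam₂)
            (greenSolI (fun t => sph lam₂ (hyp t)) (sphDecay lam₂) g) t := by
  have h0 := partial_sum_le_of_even hlam hlam₂ hg hM hM0 hε hε₂ hC hg0 hle (n := 0) (by decide) ht
  have h1 := le_partial_sum_of_odd hlam hlam₂ hg hM hM0 hε hε₂ hC hg0 hle (n := 1) (by decide) ht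
  simp only [Finset.sum_range_succ, Finset.sum_range_zero, pow_zero, one_mul, zero_add, pow_one,
    Function.iterate_one] at h0 h1
  refine ⟨h0, ?_⟩
  have e : (greenSolI (fun t => sph lam₂ (hyp t)) (sphDecay lam₂))^[1 + 1] g
      = greenSolI (fun t => sph lam₂ (hyp t)) (sphDecay lam₂)
          (greenSolI (fun t => sph lam₂ (hyp t)) (sphDecay lam₂) g) := rfl
  rw [e] at h1
  exact h1

end measure

end Summit.Ventures.HodgeRepro2.T5SU11ResolventNeumannBounds
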